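import Mathlib
import Literature.MathematicalPhysics.QuantumFieldTheory.Balaban1983to89.B4ThmAlphaUniform
import Literature.MathematicalPhysics.QuantumFieldTheory.Balaban1983to89.B4RuledReadings
import Literature.MathematicalPhysics.QuantumFieldTheory.Balaban1983to89.B4LpChain221
import Literature.MathematicalPhysics.QuantumFieldTheory.Balaban1983to89.DagBinding

/-!
# `Balaban1983to89.B4Carve41Sects12Hyp` — [Balaban1983RegularityDecay] pp. 571–585 (+ p. 586 ll. 1–15): Sect. 1
# «Introduction. Formulations of Theorems» ((1.1)–(1.22): the definitions (1.1)–(1.7), the lower bound (1.8), the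
# THEOREM p. 573 (= Proposition 2.1 of [1]) (1.9)–(1.12), «Proposition 2.3 of [1]» (1.13)–(1.20) and «Proposition 3.1′ of
# [2]» (1.21)–(1.22) p. 574) and Sect. 2 «Generalized Random Walk Representation. Proof of the Theorem» ((2.2)–(2.51):
# the cubes □_j, the partition of unity h_j, the parametrix G₀ (2.2) and the commutator formulas (2.3)–(2.11), the
# expansion (2.12)–(2.13), the Hölder norm (2.14), LEMMA 2.1 (2.15), LEMMA 2.2 (2.16)–(2.17), the proof of the Theorem
# (2.18)–(2.22), the proof of Lemma 2.1 (2.23)–(2.29) with the block bound (2.27), COROLLARY 2.3 (2.30), the proof of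
# Lemma 2.2 (2.31)–(2.34) and (2.38)–(2.41), LEMMA 2.4 (2.35)–(2.37) and its proof (2.42)–(2.51)):
# P6 CARVING-FAN BLOCK 41 — the block's one residual printed sentence in hypothesis form and ONE hypothesis bundle
# `Hyp` of the pages' printed statements BY NAME, keyed to the consumer (`stmt-QuantumFields-20542`, K1⁷; DAG leaf `b4`
# of `DagBinding.Upstream.ofPrinted` = `B4.LeafB4 …` = Theorem p. 573 ∧ Prop. 2.3 ∧ Prop. 3.1′ ∧ Sect. 5 Theorem, of
# which the first three are STATED on this block's pages; the Sect. 5 Theorem p. 594 is block 42's)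

statement-level skeleton of published theorems with citation tags; proofs where landed; nothing here is a claim about the
Yang–Mills mass gap

T. Bałaban, *Regularity and decay of lattice Green's functions*, Commun. Math. Phys. **89** (1983) 571–597,
doi:10.1007/bf01214744 `[Balaban1983RegularityDecay]` (cell paper "B4"; journal page = PDF page + 570).  STATUS:
published, refereed.  PDF held: `paper:balaban1983-cmp89-regularity-decay`; pp. 571–586 [PDF 1–16] read by this seat on
the text layer (`p0001.txt` … `p0016.txt`; line locators `pNNNN:Ln` below), on the renders
`run/shared/lean/pub/pub-balaban/b2b-balaban-ref1/pages/1983-cmp89-regularity-decay/1983-cmp89-regularity-decay-p005-x2.png`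
(p. 575, read AS IMAGE, 2026-08-28) and against the cell's verbatim transcript
`run/shared/lean/pub/pub-balaban/b2b-balaban-b04/transcript-B4.md` (pp. 571–586).  [1], [2] of the paper =
`[Balaban1982Higgs1]`, `[Balaban1983Higgs2]` ((Higgs)₂,₃ I, II; cell context B1, B2); [6] = Dunford–Schwartz I
(Riesz–Thorin).  PRINT CONVENTION (transcript, GLOBAL ERRATUM): every in-text reference to a §1 display on p. 573 is low
by four («the inequalities (1.5) and (1.6)» = (1.9), (1.10)); p. 575 «the regularity condition (1.4)» = (1.7).

CITATION HEADER (lean-in-tree rule).  Cell `lit-balaban` (HOME `run/shared/lean/pub/lit-balaban/`), P6 CARVING FAN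
(D-0154 (3b)), RESERVE block 41 of `carve/BLOCKS-41-48.md` (lead g31 RULING #10, `carve/STATUS.md` 08:16:31Z; claimed
by seat `carve-29`, first «CLAIM block 41» stamp 08:37:22Z): «[B4] Sects. 1–2 pp. 571–585: Thm p.573 (= Prop 2.1 [1]),
Props 2.3 [1] ∕ 3.1′ [2] p.574, generalized random walk (2.1)–(2.51), Lemmas 2.1, 2.2, 2.4, Cor 2.3; 35 SKELETON rows
(proved-existing 19, proved 16); KEY stmt-QuantumFields-20542, also-feeds 20544».  BOUNDARY NOTE of the block row:
(2.50)–(2.51) print on p. 586 ll. 3–6 [PDF 16] and are read with THIS block together with p. 586 ll. 7–15 (the end of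
the proof of Lemma 2.4, «Thus we have proved Lemma 2.4, hence also the Theorem.»); block 42 starts at Sect. 3, p. 586
l. 16.  RULES (`carve/CARVE-RULES.md` §2): IN TREE = CITE, NEVER RESTATE; residual printed statements in hypothesis
form `def …Printed : Prop`; ONE bundle `Hyp`; no `instance`, no `notation`, 0 `sorry`; RULING #9 (standing smallness
displayed as a threshold binder — every statement below already carries «for e sufficiently small» as `∃ e₁ > 0, ∀ i,
0 < e ≤ e₁ → …` in the tree's typing); ADDENDUM 08:22:25Z (≤ 15 new declarations; cite-only where the tree holds it).

## WHAT THE BLOCK'S PAGES PRINT AND WHERE THE TREE HOLDS IT (cite table — all 35 SKELETON rows of the block are IN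
## TREE (16 proved, 19 proved-existing), every NAMED statement of pp. 573–582 is a typed leaf of `…Balaban1983to89.B4`
## and is PROVED by the tree on concrete carriers; nothing below is restated)
* p. 571 [PDF 1] — title, abstract, §1 lead-in («if G is a lattice Green's function, then ‖Gf‖₂, ‖∂_μGf‖₂,
  ‖∂_μ∂_νGf‖₂ ≤ c‖f‖₂», «|C_{m²}(x,y)| ≤ O(1)|x−y|^{−d+2}e^{−m|x−y|}» — motivation, no statement of the paper).
* p. 572 [PDF 2], rows B4.Eq1.1 … B4.Eq1.7, B4.Eq1.1-1.20 — the definitions: (1.1) blocks `B^k(y)` and «big blocks: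
  cubes of size M … M is a large positive integer defined later in this paper» (`p0002:L11–L12`; `B4Reflection242.blk`,
  `B4RegionCubeCarrier.inBox`, `LatticeFieldCalculus.siteAvg`; the «defined later» is p. 579 — §1 below); (1.2)
  `U(A) = e^{qeηA}` (`B4GaugeCovariance.OrthFlow`); (1.3) the covariant Neumann Laplacian (`B4GaugeCovariance.bondDiff`);
  (1.4) `Q_k(A)` (`B4GaugeCovariance.avgOp`); (1.5) `P_k(A) = Q_k^*Q_k` (`B4GaugeCovariance.projOp`, `B4Eq15Projection`);
  (1.6) `G_k(Ω,A)` (`B4GaugeCovariance.covOp`, `B4TorusRegionOp`); (1.7) regularity «|(∂^η_μA)(x)| ≤ ce^{β−1} … c is some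
  universal constant» (`p0003:L2`; the predicate field `regular` of `B4.EtaSetting`, concrete `B4ThmRegionPairEta.regionPairFam`,
  `B4Lower18Regular.regularBoxSetting`); standing «We consider subsets Ω which are unions of big blocks» (`p0002:L12`;
  the field `bigBlocks` of `B4.EtaSetting`, `B1TorusRegionHSizes.IsBigBlockUnion`).
* p. 573 [PDF 3], row B4.Eq1.8 — «The operator defining the Green's function (1.6) has a strictly positive lower bound.
  More exactly we prove that there exists a positive constant γ₀ such that for e sufficiently small and for a regular
  vector field A, −Δ^{η,N}_{A,Ω} + aP_k(A) ≥ γ₀I. (1.8) The constant γ₀ is independent of the lattice spacing η, as well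
  as of Ω and of A.» (`p0003:L3–L7`): `B4.Claim18Printed` (typed verbatim, `γ₀, e₁` before the instance), PROVED on the
  tree's carriers — `B4ThmRegionPairEta.claim18Printed_regionPairFam`, `B4ThmTorusPairEta.claim18Printed_torusPairFam`,
  `B4Lower18Regular.claim18Printed_regularBox`, `B4Lower18RegularRegion.claim18Printed_regularRegion` (regular field),
  `B4Claim18Zero.claim18Printed_zeroField`, `B4Claim18ZeroTorusEta.claim18Printed_torusEtaFam` (A = 0).  Bundle member
  `Hyp.c18`.
* p. 573, rows B4.Thm@573, B4.Eq1.17 — **THEOREM (Proposition 2.1 of [1])** (`p0003:L12` ff.) with (1.9)–(1.12) and its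
  last sentence («For some simple sets Ω, e.g. for rectangular parallelepipeds, the inequalities hold without any
  restrictions on the points x, x′»): typed leaf `B4.ThmPrinted` over `B4.EtaSetting` families (displays `B4.Ineq19_110`,
  `B4.Ineq111_112`; the (1.12) print defect — the same distance printed twice — resolved from the proof p. 579, cell
  DIVERGENCE D-b04.2, in `Ineq111_112`'s docstring).  READINGS OF RECORD: the cell referee's RULING G-ref1-32
  (`B4RuledReadings`): faithful Hölder range `0 ≤ α < 1` = `B4.ThmPrintedNN` (:= `B4Ineq111ZeroNestEta.ThmPrintedNN`;
  `B4.ThmPrinted.nn`; the literal «α < 1» leaf is REFUTED at `α = −1` on the zero-field carriers,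
  `B4Thm19ZeroBoxNegAlpha.not_thmPrinted_boxFam`), and the print's dependency clause «δ₀, c₀, R₀ independent of A, k, Ω
  and depending on d, M only, c₀ on α also» displayed as quantifier order = `B4ThmAlphaUniform.ThmPrintedNNUnif`
  (`δ₀, R₀` before `α`; `thmPrintedNN_of_unif`).  PROVED: `B4ThmAlphaUniform.thmPrintedNNUnif_regionPairFam` (general
  pairs `Ω ⊂ Ω₀` of unions of big blocks in `ηℤ^d`, (1.7)-regular field), `thmPrintedNNUnif_torusPairFam` (subsets of
  `T_η`, NODE 00's family of record), `B4ThmRegionPairEta.thmPrintedNN_regionPairFam`, `B4ThmTorusBox.thmPrintedNN_torusBoxFam`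
  (the «rectangular parallelepipeds» sentence), zero field `B4Ineq111ZeroNestEta.thmPrintedNN_nestFam`; dependency form
  consumed by [B5]: `B5FromB4.ThmDepPrinted`, `B5FromB4NN.ThmDepPrintedNN`.  Bundle member `Hyp.thm` (the `Unif` reading;
  `Hyp.thmNN` derives the ruled leaf, the DAG N-binding's conjunct).
* p. 573 «This theorem implies in particular the Proposition 2.3 of [1]» + rows B4.Eq1.13, B4.Eq1.14 — (1.13)
  `C^{(k)}_Λ(Ω,A)` (`B4GaussRep36.cOpLam`), (1.14) `Δ^{(k)}(Ω,A) = a_kI − a_k²Q_kG_kQ_k^*` (`B4.UnitSetting`, field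
  `form115`; `B4Delta112ZeroTorusCube`); the implication itself is Sect. 3 (block 42, `B4GaussRep36`, `B4Sect3BlockAveraging`).
* p. 574 [PDF 4], row B4.Prop2.3[I] — **PROPOSITION 2.3 of [1]** (`p0004:L2` ff.) (1.15)–(1.20) «There exist positive
  constants δ₀, c₀, γ₀, γ₁ dependent on d and M only and such that for arbitrary Λ ⊂ Ω^{(k)} … Λ being a sum of big
  blocks and for e sufficiently small …»: `B4.Prop23Printed` (typed verbatim over `B4.UnitSetting`), PROVED
  `B4Prop23RegularFamily.prop23Printed_regularRegions`, `B4Prop23TorusFamily.prop23Printed_torusRegionsW`,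
  `B4Prop23RegularWindow.prop23Printed_regularWindow`, zero field `B4Prop23ZeroRegion.prop23Printed_zeroFieldRegions`,
  `B4Ineq118Torus.prop23Printed_torusFam`; its two printed proofs are Sect. 3 and Sect. 5 (block 42).  Bundle member
  `Hyp.p23`.
* p. 574, row B4.Prop3.1'[II] — «The last theorem we have to prove is the bound from below for the operator Δ^{(k)}(Ω,A).»
  **PROPOSITION 3.1′ of [2]** (`p0004:L18` ff.) (1.21)–(1.22) «… there exists a positive constant γ₀ depending on d only,
  such that for e sufficiently small … for arbitrary α > 0 and a constant O(1) depending on α and the other constants,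
  but independent of Ω, k, A»: `B4.Prop31Printed` (typed verbatim over `B4.FormSetting`; `γ₀, e₁` before `α`, `O(1)`
  after), PROVED `B4Prop31Regular.prop31Printed_regularRegion`, `B4Prop31Sect4Route.prop31Printed_regularRegion_sect4`
  (along the printed Sect. 4 route), `B4Prop31TorusFamily.prop31Printed_torusRegions`, `B4Prop31Zero.prop31Printed_zeroField`;
  kernel bookkeeping of its Sect. 4 constants `B4.prop31_gamma0`, `B4.gamma0prime_chain`; proof = Sect. 4 (block 42).
  «This theorem implies (3.29) of [2]» — cross-reference only.  Bundle member `Hyp.p31`.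
* p. 574 ll. 30–34 plan of the paper («The theorems will be proven in Sects. 2–4 … The fifth section … a general theorem
  concerning operators on the unit lattice Z^d … gives another proof of Proposition 2.3») — no statement.
* pp. 574–575 [PDF 4–5], rows B4.Def§2, B4.Eq2.2 — «it is sufficient to prove the Proposition [= the Theorem] for a
  function f with support in a unit cube Δ₀ … summing the inequalities»; the cubes «□_j = Ω ∩ {a sum of large blocks for
  which the point Mj is one of the vertices}» (unnumbered — the paper has NO display (2.1)), «if the point Mj is not a
  boundary point of Ω, then □_j is a cube of the size 2M and with center in Mj. For Mj lying on the boundary the set □_j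
  is a sum of several large blocks» (read «(≤ 2^d)» by the tree: `B4RegionCubeCarrier.boxEmb`, `B4SubBoxCarrier.subEmb`,
  `B4Thm110BoxCut.jloc`, `B1TorusCubeCover.cube`); the partition of unity `h_j(x) = Π_μ h(x_μ/M − j_μ)`, `h ∈
  C₀^∞(]−2/3, 2/3[)`, `h = 1` on `[−1/3, 1/3]`, `Σ_j h_j² = 1` (`B4PartitionUnity22.hprof`, `hCube`, `hasSum_hCube_sq`,
  `hprof_eq_one_third`, `tsupport_hprof_subset_Ioo` — PROVED with an explicit profile); (2.2) `G₀ = Σ_j h_jG_k(□_j,Ã_j)h_j`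
  and the fields `Ã_j` («if □_j intersects the boundary of Ω, then Ã_j = A; if □_j is an interior cube … Ã_j = A₀ + θ_jA′»,
  «A₀ = A(Mj) … |A′|, |∂^η_μA′| ≤ c′e^{β−1}, with c′ depending on c, d, and M, more exactly c′ = dMc», `θ ∈ C₀^∞(]−1,1[)`,
  `θ = 1` on `[−3/4, 3/4]`): `B4CubeGreenRegion.cubeGreenI` ∕ `cubeGreenB`, `B4Thm110RegionLp.atField` ∕ `atGreen`,
  `B4Thm110BoxUniform.baseVal` (the «c′ = dMc» clause), `B4PartitionUnity22.thetaProf` ∕ `thetaCube` ∕ `thetaCube_eq_one`,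
  `B1TorusRegionCubes.G0`; (2.2) as parametrix `B4Commutators25to211.parametrix_identity`.
* pp. 575–576 [PDF 5–6], rows B4.Eq2.3, B4.Eq2.10 — (2.3)–(2.9) (Leibniz rules for `D^η_A`, `D^{η*}_A`, the commutator
  (2.5), the boundary remark (2.6) «because the function h_j can be ≠ 0 only on the part of the boundary of □_j which is
  contained in the boundary of Ω», (2.7), (2.8) with `R_k(A,∂^ηh)`, the parametrix identity (2.9) «where we have used …
  Σ_j h_j² = 1»), (2.10) `K_j`, (2.11) `R = Σ_j K_jG_k(□_j,Ã_j)h_j`: `B4Commutators25to211.fld_bondDiff_mulH` (2.3),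
  `fld_covLap_mulH` (2.5), `fld_projOp_mulH` (2.8), `opK`, `opK_eq` (2.7)–(2.10), `sum_mulH_sq_eq_one`,
  `B1TorusCubeLocality26.rS` ∕ `B1TorusCubeBoxOp.boxPair` (2.6), `B1TorusRegionCubes.Rop` (2.11) — PROVED identities.
* p. 577 [PDF 7], rows B4.Eq2.12, B4.Eq2.14 — «R is a small operator in reasonable norms because |∂^ηh_j| ≤ O(M^{−1}),
  |Δ^ηh_j| ≤ O(M^{−2})» (`p0007:L2–L3`; PROVED `B4PartitionUnity22.abs_latticeDeriv_hCube_le`,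
  `abs_latticeLaplacian_hCube_le`, uniformly in `η`); (2.12) `G_k(Ω,A) = G₀(I − R)^{−1} = Σ_n G₀R^n` and the random-walk
  form (2.13) with «the obvious fact that G_k(□_j,Ã_j)h_jK_{j′}G_k(□_{j′},Ã_{j′}) = 0, if |j − j′| > 1»
  (`B4RandomWalk213.order_term_eq_sum_walks`, `G_mul_one_sub_eq`, `hasSum_of_norm_lt_one`, `cubeAdj`,
  `B4PartitionUnity22.hCube_labels_adjacent`, `B1TorusLabelWalk.LAdj`); the remark after Lemma 2.1 «Lemma 2.1 implies
  that the L²-norm of the operator R given by (2.11) is small for M large enough, so the series in the representation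
  (2.12) is convergent in this norm» (`B4RandomWalk213.hasSum_of_norm_lt_one`, `B4Eq222SupDecay.norm_weighted_remainder_le`,
  `B4LpChain221.chain_bound_221`); (2.14) the Hölder norm `‖·‖_{1,α}` with its convention «the same vector field is in
  the norm (2.14) as in these expressions» (the field `holder1` of `B4.CubeSetting`, concrete `B4Lemma22RegularCubeFam.RegInst.hold`,
  `B4Lemma22RegFieldFam.RegFieldInst.hold`, `B4Lemma21Zero.ZeroFieldCube.hold`).
* p. 577, row B4.Lem2.1 — **LEMMA 2.1** (`p0007:L25` ff.) (2.15) «Let a set □ be an arbitrary sum of unit blocks, but such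
  that it is a sum of at most few large blocks, and let A be as in the theorem. Then for e sufficiently small we have …
  ≤ c₂‖f‖₂»: `B4.Lemma21Printed` (typed verbatim over `B4.CubeSetting`), PROVED `B4Lemma21Region.lemma21Printed_regularRegion`
  (regular field, proof pp. 579–580), `B4Lemma21RegularWindow.lemma21Printed_regularRegionW` («c₂ independent of k, □»),
  `B4Lemma21Zero.lemma21Printed_zeroField`.  Bundle member `Hyp.l21`.
* pp. 577–578 [PDF 7–8], row B4.Lem2.2 — **LEMMA 2.2** (`p0007:L32` ff., `p0008:L2–L4`) (2.16)–(2.17) «Let a rectangular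
  parallelepiped □ be a sum of few large blocks … Ã … regular … constant in a neighbourhood of the boundary of □. Then for
  e sufficiently small and α < 1, there exists a constant c₁ depending on d, α only … (2.16) and a constant c₂ depending
  on d, p₁, such that … (2.17) for 1 ≤ p, q ≤ ∞, satisfying the condition 1/p − 1/p₁ ≤ 1/q ≤ 1/p with p₁ > d»:
  `B4.Lemma22Printed` (typed verbatim; exponents by reciprocals), PROVED `B4Lemma22RegularCubeFam.lemma22Printed_cubeFieldFam`,
  `B4Lemma22RegFieldFam.lemma22Printed_regFieldFam` (regular field), zero field `B4Lemma22ZeroBoxLpLq.lemma22Printed_cubeFam`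
  with the SHARPNESS of «p₁ > d» `B4Lemma22ZeroBoxSharp.not_lemma22Printed17_cubeFam` ∕ `lemma22Printed_cubeFam_iff`;
  partial leaves `B4Lemma22ZeroBoxCube.Lemma22Printed16` ∕ `Lemma22Printed17Diag` ∕ `Lemma22PrintedDiag`.  (On cubes of a
  few large blocks the literal «α < 1» incl. `α < 0` is harmless — bounded diameter — and is proved as typed.)  Bundle
  member `Hyp.l22`.
* p. 578 [PDF 8], rows B4.Eq2.18, B4.Eq2.24 (first part) — «These two lemmas together with the representation (2.13) imply
  the theorem.» (`p0008:L5`) and the proof of (1.9): the reduction to `|x′ − x| ≤ 1`, «the first situation occurs for at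
  most 2^d cubes □_j» (`B4Sect5CubeBounds.cand`), (2.18), the radius (2.19) `R₀ = (diameter of ∪ … □_{ω_i}) + 2M` «R₀
  depends on M and n₀» (`B4LpChain221.reach_219`, `B4Ineq110LpChain` — `R₀` in label form, `good_of_reach`), the split
  `n ≤ n₀` ∕ `n > n₀` with (2.20), (2.21) and «we apply (2.17) with 1/p₁ = 1/(2n₀) and we fix n₀ such that p₁ = 2n₀ >
  d + 1, e.g. n₀ = d» (`p0008:L33–L34`; KERNEL-CHECKED `B4LpChain221.p1_choice`: valid iff `d ≥ 2`; the exponent ladder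
  `adm217_step`, `chain_range`, `chain_bound_220`, `chain_bound_221`, `l2_le_sup`): PROVED bookkeeping; the assembled
  theorem is `thmPrintedNN_regionPairFam` above (the sentence `p0008:L5` realised in the kernel).
* p. 579 [PDF 9], rows B4.Eq2.18 (end), B4.Eq1.17 — «the basic reason for the restriction dist({x,x′},Ω^c) ≥ R₀ is that we
  do not have the inequalities (2.16) for the norms other than L²-norms if □_j is not a cube», the path count «n ≥
  M^{−1}dist({x,x′}, supp f) − 2. There are at most 2^d(3^d)^{n−1}2^d of such paths» (`B4RandomWalk213.card_walks_le`,
  `le_length_of_separated`, `card_cubeAdj_le`), (2.22) with «if M is fixed such that 3^dc₂O(1)M^{−1} ≤ e^{−1}»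
  (`p0009:L12–L13` — THE RESIDUAL, §1 below; in the tree only as the binders `hx : x ≤ Real.exp (-1)` of
  `B4LpChain221.tail_222`, `h3β : 3^d * β ≤ Real.exp (-1)` of `B4Ineq110LpChain` ∕ `B4Ineq110WalkRouteDeriv`, and
  `m₀βe^{δ·diam} ≤ ½` of `B4Eq222SupDecay`; the printed prefactor «2^{d+1}/e²» of (2.22) is `2^{d+1}e^{+2}` —
  `tail_222` docstring, absorbed in `c₀`); the `δG_k(Ω,Ω₀,A)` paragraph («the terms with … interior cubes … cancel in the
  difference … with the additional restriction that at least one □_{ω_i} intersects the boundary ∂Ω … n ≥ (2M)^{−1}(dist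
  ({x,x′}, supp f) + dist({x,x′}, Ω^c) + dist(supp f, Ω^c)) − 3», which FIXES the reading of (1.12)):
  `B4RandomWalkDelta112.Avoids`, `diff_cut_order_term_eq`, `through_of_separations`, `lattice_walk_delta_bound`,
  hypothesis form `B9Thm314.StepCountPrinted`; «if Ω is a rectangular parallelepiped, then all □_j … are cubes and we can
  apply Lemma 2.2 to all operators in it, so the restriction … is unnecessary» (`B4BoxNeumannGauge.faceData`,
  `B4ThmTorusBox.thmPrintedNN_torusBoxFam`, `B4ThmBoxPairEtaNoCollar.thmPrintedNN_boxPairFamNC`); «Thus we have proved the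
  theorem, or rather reduced it to Lemmas 2.1, 2.2.» (`p0009:L28–L29`).
* pp. 579–580 [PDF 9–10], rows B4.Eq2.24, B4.Eq2.25, B4.Eq2.27 — proof of Lemma 2.1: (2.23) `A = A₀ + A′`, «c′ depends on
  c and M» (`B4Lower18RegularRegion.blockConst`, `B4Lower18Regular.regularBoxSetting`), the expansion (2.24) with `F_{1,k}`,
  `F_{2,k}`, `V_k` (`B4Lower18Regular.pertE`, `vOp`, `crossOp`, `quadOp`), (2.25) «holding for some absolute constant c₀»,
  «‖G^{1/2}V_kG^{1/2}‖_{2,2} ≤ O(1)e^β, with a constant O(1) depending on M only. For e sufficiently small, we get the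
  representation (2.26)» (`p0010:L7–L9`; `B4TwoScaleForm.CellData.norm_bound_228`, `B4TwoScaleForm.sum_gradS_le`,
  `B4Ineq228OperatorOrder`), the block bounds (2.26bis)–(2.29) incl. **(2.27)** «⟨φ, (−Δ^{η,N}_Δ + a_kP_k)φ⟩ ≥ min{π², a_k}
  ‖φ‖_{L²(Δ)}» (typed leaf `B4.Display227Printed`; census G-B4-03 — the Neumann gap is `4η^{−2}sin²(πη/2) ∈ [8, π²[`,
  never `π²`; repaired `B4.Display227Repaired`, both EQUAL for `a_k ≤ 8`, `B4.display227_moot`,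
  `display227_printed_iff_repaired`; PROVED `B4Block227.display227Printed_blockForm`, `block227`, `torus_green_bound`
  (2.28)); «Thus the Lemma 2.1 is proved.»  Bundle member `Hyp.d227`.
* pp. 580–581 [PDF 10–11], row B4.Cor2.3 — «Remark. Let us notice that this lemma alone implies a weaker version of
  Proposition I.2.1 with L²-norms. More exactly we have» **COROLLARY 2.3** (`p0010:L35–L37` ff.) (2.30) + p. 581 ll. 1–6
  «The same inequalities hold for δG_k(Ω,Ω₀,A) with the additional factor e^{−δ₀(dist(supp f,Ω^c) + dist(supp f′,Ω^c))}.
  Of course it is enough to prove it for f, f′ with supports in unit cubes … using only the L²-bounds of Lemma 2.1. …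
  now there are no restrictions on supports of f, f′»: `B4.Cor23Printed` (typed verbatim incl. the `δG` clause, fields
  `pair` ∕ `dpair` of `B4.EtaSetting`), PROVED `B4Cor23RegionPairFam.cor23Printed_regionPairFam` (same family as the
  Theorem), `B4Cor23TorusPairFam.cor23Printed_torusPairFam`, `B4Cor23RegionEta.cor23Printed_regularPair`,
  `B4Cor23RegularWindow.cor23Printed_regularPairW`, zero field `B4Cor23ZeroEta.cor23Printed_zeroField`; the mechanism
  «Lemma 2.1 alone ⇒ (2.30)» is `B4RandomWalk213.lattice_walk_decay_bound` ∕ `B4RandomWalkDelta112.lattice_walk_delta_bound`.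
  Bundle member `Hyp.c23`.
* pp. 581–582 [PDF 11–12], rows B4.Eq2.31, B4.Eq2.34 — proof of Lemma 2.2, first reduction: (2.31) «Now we have to choose
  A₀ more carefully … Ã = A₀ + A′, the configuration A′ is regular and has a compact support in □», (2.32) «Thus it is a
  first order differential operator with small coefficients. Only here we needed the assumption that Ã is constant in a
  neighbourhood of ∂□», (2.33) «The series on the right hand side is convergent for e sufficiently small, and we get the
  inequality (2.16). The inequality (2.17) is proved in the same way» (`p0011:L36`), the gauge reduction `A₀ ↦ 0`:
  PROVED `B4Lemma22Reduce231.expansion231`, `firstOrderSmall_of_decomp` (2.32), `bootstrap`, `partialSum_le_geom`,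
  `transfer` (2.33), `B4Lemma22ReduceZero`, `B4BoxNeumannGauge.gaugeFn`; (2.34) the renormalization group formula
  `G_k(□) = C^{(0),η}(□) + Σ_j a_j²(L^jη)^{−4}G^η_jQ_j^*C^{(j),L^jη}Q_jG^η_j` (`B1RG242.Tower.display243`).
* p. 582 [PDF 12], row B4.Lem2.4 — **LEMMA 2.4** (`p0012:L10` ff.) (2.35)–(2.37) «There exist positive constants c₀, δ₀,
  and for α < 1, there exists a constant c₁, such that … for arbitrary non-negative integer j, arbitrary, rectangular
  parallelepiped □ ⊂ L^{−j}Z^d built of large blocks»: typed leaf `B4.Lemma24Printed` over `B4.ScaleSetting`; READING OF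
  RECORD (RULING G-ref1-32 item (2)): `B4.Lemma24PrintedNN` (:= `B4Lemma24ZeroBoxScale.Lemma24PrintedNN`, `0 ≤ α < 1`;
  `B4.Lemma24Printed.nn`, `Lemma24Printed.bounds235_237`; the literal leaf is REFUTED at `α = −1`,
  `B4Lemma24ZeroBoxAlphaNeg.not_lemma24Printed_zeroFieldScales`), PROVED `B4Lemma24ZeroBoxScale.lemma24PrintedNN_zeroFieldScales`
  (Lemma 2.4 is a zero-field statement: `G_j(□) = G_j(□,0)`), `B4Lemma24TorusScales.lemma24PrintedNN_torusScales`; its one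
  tree consumer `B5Ineq113.h113_of_display136`.  Bundle member `Hyp.l24` (the ruled leaf).
* pp. 582–583 [PDF 12–13], row B4.Eq2.38 — proof of (2.16) for `G_k(□)` from (2.34) + Lemma 2.4: (2.38)–(2.39), «c′₁ is
  built of c₀, c₁, Σ_{x∈Z^d}e^{−δ₀|x|}, Σ_{j=1}^∞(L^{−j})^{1−α}» (`p0013:L2`; the only place `α < 1` enters); the
  **Remark** p. 583 ll. 4–6 «the above method can be used also to prove pointwise estimates of G_k(□), G_k(□,A), and even
  G_k(Ω,A), their derivatives and "Hölder-derivatives"» (method remark, no statement; the tree's pointwise route is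
  `B4Eq222SupDecay`); (2.17) for `G_k(□)`: «For q = p = ∞ … special case of (2.16) … For q = p = 1 … by duality … The
  Riesz-Thorin Theorem implies it for arbitrary q = p», (2.40)–(2.41) `L^{p₁} → L^∞` for `p₁ > d` with «c′₂ is built of
  c₀, Σe^{−δ₀|x|}, Σ_j(L^{−j})^{1−d/p₁}», the interpolation figure, «Thus Lemma 2.2 is proved, or rather reduced to Lemma
  2.4»: PROVED `B4Lemma22ZeroBoxCube.lemma22Printed16_cubeFam`, `lemma22Printed17Diag_cubeFam`, `B4Lemma22ZeroBoxLpLq`,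
  `B4Lemma22ZeroLatticeLpOperators`, `B4Lemma22LpStair.lpM`, `B4Lemma22EtaBox.lpW`, dimension one `B4Lemma22ZeroBoxDimOne`.
* p. 584 [PDF 14], rows B4.Eq2.42, B4.Eq2.43 — proof of Lemma 2.4: «(2.37) … is a special case of Proposition 2.3. The
  proof of this proposition will be given in the next section and is based on Corollary 2.3 only. Thus we can assume that
  (2.37) is proved» (non-circularity note; `B4.Lemma24Printed` docstring, `B4Prop23ZeroBox`); «This part of the argument
  is valid for an arbitrary rectangular parallelepiped □ built of unit blocks, so the inequalities [(2.35), (2.36)] are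
  valid for all such sets» (scope remark, quoted in `B4Lemma24ZeroBoxScale`'s header l. 37; not re-typed — its displays
  are Lemma 2.4's); (2.42) the multiple reflection formula (`B4Reflection242.blk` and the module `B4Reflection242`);
  (2.43)–(2.48) Fourier transform on `ξZ^d`, the equation (2.44)–(2.45), the solution (2.46), (2.47)–(2.48) the momentum
  formula for `G_jQ_j^*` (`B4Eq243TransformSummable.ftSum`, `B4Strip.U`, `B4Strip.E`, `B4Strip.uFactor`).
* pp. 585–586 l. 15 [PDF 15–16], row B4.Eq2.49 — (2.49) with «we have assumed that |x′−y| ≤ |x−y|», the four elementary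
  bounds on `u_j`, `Δ¹/Δ^ξ`, `∂^ξ_μ`, `|x−x′|^{−α}|e^{i(p′+l)·(x−x′)} − 1|`, (2.50) «≥ O(1) > 0», (2.51) «≤ O(1), the
  constant depends on α < 1» (p. 586 ll. 3–6), and p. 586 ll. 7–11 «The expression is a function of p′ and can be extended
  as an analytic function to some neighbourhood of [−π,π]^d. It is more troublesome, but equally elementary, to prove that
  this neighbourhood can be chosen independently of j and that the expression is bounded also in this neighbourhood»
  (ASSERTED, NOT WRITTEN in print = census G-B4-02; typed AND PROVED by the audit: `B4Strip.UniformStrip`, `B4Strip.S1r`,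
  `B4Strip.Delta1`), the complex shift «in the direction of the vector x′−y … e^{−δ₀|x′−y|} = e^{−δ₀dist({x,x′},y)}. We
  get the inequality (2.36). The inequalities (2.35) are proved in the same way and constants depend on d only. Thus we
  have proved Lemma 2.4, hence also the Theorem.» (`p0016:L8–L15`; `B4Lemma24ZeroBoxScale.bound236_zeroFieldScales`,
  `bounds235and237_zeroFieldScales`).

## WHAT THIS FILE ADDS
§1 ONE RESIDUAL PRINTED SENTENCE with no declaration of record (searched 2026-08-28: `HOME/EXISTING-DECLS.tsv`, 7489 rows
citing `Balaban1983RegularityDecay`, locators pp. 571–586 ∕ (1.1)–(2.51); `rg` over `Balaban1983to89/B4*.lean`,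
`B1Torus*.lean` for the prose candidates of the block row — every other unnumbered sentence of pp. 571–586 l. 15 resolves
to a tree declaration, see the table; in particular «e.g. n₀ = d» is `B4LpChain221.p1_choice`, «|∂^ηh_j| ≤ O(M^{−1}),
|Δ^ηh_j| ≤ O(M^{−2})» is `B4PartitionUnity22.abs_latticeDeriv_hCube_le` ∕ `abs_latticeLaplacian_hCube_le`, the uniform
strip of p. 586 is `B4Strip.UniformStrip`): `MFixedPrinted` — p. 579 ll. 12–13 «if M is fixed such that 3^dc₂O(1)M^{−1}
≤ e^{−1}», THE PAPER'S CHOICE OF ITS LARGE-BLOCK SIZE `M` (announced p. 572 ll. 11–12 «M is a large positive integer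
defined later in this paper»; the `M` of «depending on d, M only» in the Theorem and in Proposition 2.3), in the tree only
as binders (`B4LpChain221.tail_222`'s `hx`, `B4Ineq110LpChain`'s `h3β`, `B4Eq222SupDecay`'s `m₀βe^{δ·diam} ≤ ½`), with
three kernel companions: the per-term decay `mFixed_term_le` («2^dc₁(3^dc₂O(1)M^{−1})^n» ≤ `2^dc₁e^{−n}`), the tail of
(2.22) `mFixed_tail_222` (BY NAME from `B4LpChain221.tail_222`), and `mFixed_exists` (such an integer `M ≥ 1` exists for
any `c₂, O(1)` — «a large positive integer»).
§2 THE BUNDLE.  `Carriers` — the families the tree types the printed statements of pp. 573–582 over (the three DAG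
families `famE`, `famU`, `famF` of `B4.LeafB4` ∕ `DagBinding.PrintedCarriers` plus the Sect. 2 families of Lemmas 2.1,
2.2, (2.27), Lemma 2.4, and `(d, N)`); `Hyp X` — (1.8), the THEOREM, PROPOSITION 2.3, PROPOSITION 3.1′, LEMMA 2.1, LEMMA
2.2, (2.27), COROLLARY 2.3, LEMMA 2.4 AS HYPOTHESES, BY NAME, in page order (the Theorem and Lemma 2.4 in their readings of
record, see the table); consumer forms: `Hyp.thmNN` (the ruled leaf `B4.ThmPrintedNN`), `Hyp.b4LeafNN` (with the Sect. 5
Theorem of block 42 ⇒ the `b4` leaf of the N-binding `DagBinding.Upstream.ofPrintedAllXPN`, i.e. `DagDischargedII.B4LeafNN`,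
definitionally), `Hyp.leafB4_of_literal` ∕ `Hyp.dag_b4` (with the LITERAL typed Theorem and the Sect. 5 Theorem ⇒
`B4.LeafB4` = the `b4` leaf of `DagBinding.Upstream.ofPrinted`; the literal leaf is NOT derivable from the ruled one and
is refuted on the zero-field carriers — recorded, not hidden), `Carriers.ofDag`.

## HONEST SCOPE
Nothing of [B4] is proved here beyond three lines of real arithmetic and bookkeeping; the nine statements are hypothesis
slots BY NAME — their PROOFS on concrete carriers are the tree's theorems cited above (regular field: the `r01` lineage
`B4ThmRegionPairEta` … `B4Prop31Regular`; zero field: the `b04`/`pv17` lineage), not re-proved and not restated.  The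
proofs of Propositions 2.3 and 3.1′ (Sects. 3–4) and the Sect. 5 Theorem are block 42's pages.  No summit statement is
proved by this seat; count-neutral; nothing continuum ∕ ℝ⁴ ∕ OS ∕ mass-gap ∕ Clay.  No `sorry`, no `instance`, no
`notation`.
-/

namespace Literature.MathematicalPhysics.QuantumFieldTheory.Balaban1983to89.B4Carve41Sects12Hyp

/-! ## §1  The residual printed sentence of p. 579 (hypothesis form) with its kernel companions -/

/-- **p. 579, ll. 12–13 [PDF 9]** (`p0009:L12–L13`), verbatim (end of the proof of (1.9), display (2.22)): «(the left hand
side of (1.9)) ≤ Σ_n 2^dc₁(3^dc₂O(1)M^{−1})^n‖f‖_∞ ≤ … e^{−M^{−1}dist({x,x′}, supp f)}‖f‖_∞, (2.22) where n ≥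
M^{−1}dist({x,x′}, supp f) − 2, and if M is fixed such that 3^dc₂O(1)M^{−1} ≤ e^{−1}.» — THE PAPER'S CHOICE OF THE
LARGE-BLOCK SIZE `M` announced on p. 572 ll. 11–12 («M is a large positive integer defined later in this paper»): `d` the
dimension (`3^d` = the number of successors of a path point, p. 577), `c₂` the constant of Lemmas 2.1 ∕ 2.2 (2.15) ∕
(2.17), `K` the printed `O(1)` of (2.20)–(2.21) (from «|∂^ηh_j| ≤ O(M^{−1}), |Δ^ηh_j| ≤ O(M^{−2})», p. 577, so that
`‖K_jG_k(□_j,Ã_j)h_j‖ ≤ c₂O(1)M^{−1}`), `M` the block size.  In the tree only as the binders `hx : x ≤ Real.exp (-1)` of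
`B4LpChain221.tail_222` and `h3β : 3 ^ d * β ≤ Real.exp (-1)` of `B4Ineq110LpChain` ∕ `B4Ineq110WalkRouteDeriv`
(`β = c₂O(1)M^{−1}`). [cite: Balaban1983RegularityDecay, p.579 ll.12–13 (after (2.22)); p.572 ll.11–12] -/
def MFixedPrinted (d : ℕ) (c₂ K M : ℝ) : Prop :=
  (3 : ℝ) ^ d * c₂ * K * M⁻¹ ≤ Real.exp (-1)

/-- Unfolding. [cite: Balaban1983RegularityDecay, p.579 ll.12–13 (after (2.22))] -/
theorem mFixedPrinted_iff (d : ℕ) (c₂ K M : ℝ) :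
    MFixedPrinted d c₂ K M ↔ (3 : ℝ) ^ d * c₂ * K * M⁻¹ ≤ Real.exp (-1) := Iff.rfl

/-- «Σ_n 2^dc₁(3^dc₂O(1)M^{−1})^n» — under the printed choice of `M` (and `c₂, K, M ≥ 0`) the `n`-th term of (2.22) is at
most `2^dc₁e^{−n}`: the walk expansion converges geometrically with ratio `e^{−1}`.  PROVED (real arithmetic).
[cite: Balaban1983RegularityDecay, (2.22) p.579] -/
theorem mFixed_term_le {d : ℕ} {c₂ K M c₁ : ℝ} (h : MFixedPrinted d c₂ K M) (hc₂ : 0 ≤ c₂) (hK : 0 ≤ K)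
    (hM : 0 ≤ M) (hc₁ : 0 ≤ c₁) (n : ℕ) :
    (2 : ℝ) ^ d * c₁ * ((3 : ℝ) ^ d * c₂ * K * M⁻¹) ^ n ≤ (2 : ℝ) ^ d * c₁ * Real.exp (-(n : ℝ)) := by
  have hx0 : 0 ≤ (3 : ℝ) ^ d * c₂ * K * M⁻¹ := by positivity
  have hpow : ((3 : ℝ) ^ d * c₂ * K * M⁻¹) ^ n ≤ Real.exp (-1) ^ n := pow_le_pow_left₀ hx0 h n
  have hexp : Real.exp (-1) ^ n = Real.exp (-(n : ℝ)) := by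
    rw [← Real.exp_nat_mul]; ring_nf
  rw [hexp] at hpow
  exact mul_le_mul_of_nonneg_left hpow (by positivity)

/-- «≤ 2^{d+1} … e^{−M^{−1}dist({x,x′}, supp f)}‖f‖_∞ … where n ≥ M^{−1}dist({x,x′}, supp f) − 2» — the tail of (2.22)
under the printed choice of `M`, BY NAME from the tree's `B4LpChain221.tail_222`: with `x = 3^dc₂O(1)M^{−1} ≤ e^{−1}` and
walks of length `N ≥ r − 2` (`r = M^{−1}dist`), `x^N/(1 − x) ≤ 2e²e^{−r}` (the printed prefactor «2^{d+1}/e²» reads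
`2^{d+1}e^{+2}`, a misprint absorbed in `c₀` — `tail_222`'s docstring).  PROVED. [cite: Balaban1983RegularityDecay, (2.22) p.579] -/
theorem mFixed_tail_222 {d : ℕ} {c₂ K M r : ℝ} {N : ℕ} (h : MFixedPrinted d c₂ K M) (hc₂ : 0 ≤ c₂) (hK : 0 ≤ K)
    (hM : 0 ≤ M) (hN : r - 2 ≤ N) :
    ((3 : ℝ) ^ d * c₂ * K * M⁻¹) ^ N / (1 - (3 : ℝ) ^ d * c₂ * K * M⁻¹) ≤ 2 * Real.exp 2 * Real.exp (-r) :=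
  B4LpChain221.tail_222 (by positivity) h hN

/-- «M is a large positive integer defined later in this paper» (p. 572) — the printed choice is CONSISTENT: for any
constants `c₂, O(1)` there is an integer `M ≥ 1` with `3^dc₂O(1)M^{−1} ≤ e^{−1}` (Archimedes).  PROVED.
[cite: Balaban1983RegularityDecay, p.572 ll.11–12; p.579 ll.12–13] -/
theorem mFixed_exists (d : ℕ) (c₂ K : ℝ) : ∃ M : ℕ, 1 ≤ M ∧ MFixedPrinted d c₂ K M := by
  obtain ⟨M, hM⟩ := exists_nat_gt (|(3 : ℝ) ^ d * c₂ * K| / Real.exp (-1))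
  have he : 0 < Real.exp (-1) := Real.exp_pos _
  have hMpos : (0 : ℝ) < M := lt_of_le_of_lt (by positivity) hM
  refine ⟨M, by exact_mod_cast hMpos, ?_⟩
  unfold MFixedPrinted
  have hle : |(3 : ℝ) ^ d * c₂ * K| ≤ Real.exp (-1) * M := by
    have := (div_lt_iff₀ he).mp hM
    linarith
  calc (3 : ℝ) ^ d * c₂ * K * (M : ℝ)⁻¹ ≤ |(3 : ℝ) ^ d * c₂ * K| * (M : ℝ)⁻¹ :=
        mul_le_mul_of_nonneg_right (le_abs_self _) (by positivity)
    _ ≤ Real.exp (-1) * M * (M : ℝ)⁻¹ := mul_le_mul_of_nonneg_right hle (by positivity)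
    _ = Real.exp (-1) := by field_simp

/-! ## §2  The bundle: (1.8), the Theorem, Propositions 2.3 and 3.1′, Lemmas 2.1 and 2.2, (2.27), Corollary 2.3 and
Lemma 2.4 as hypotheses, by name -/

/-- **Carriers of the block-41 bundle**: the families over which the tree types the printed statements of pp. 573–582 —
the three families of the DAG leaf `b4` (`B4.LeafB4`, `DagBinding.PrintedCarriers.famE ∕ famU ∕ famF` with `d4, N4`):
`famE` (η-lattice settings `B4.EtaSetting`: (1.8), the Theorem, Corollary 2.3 — «If Ω and A are as in Proposition I.2.1»,
one family for all three, as the tree's `regionPairFam` ∕ `torusPairFam` prove all three), `famU` (`B4.UnitSetting`: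
Proposition 2.3), `famF` (`B4.FormSetting`: Proposition 3.1′), the pair `(d, N)` of the Sect. 5 Theorem (block 42; `d` is
also the `d` of Lemma 2.2's «p₁ > d»); and the Sect. 2 families: `famC₁` (`B4.CubeSetting`: Lemma 2.1, «□ … a sum of at
most few large blocks», field `A`), `famC₂` (`B4.CubeSetting`: Lemma 2.2, rectangular `□`, field `Ã` constant near `∂□`),
`famB` (`B4.BlockForm`: (2.27), unit cubes `Δ`), `famS` (`B4.ScaleSetting`: Lemma 2.4, scales `j`).  Plain data, no
instances. [cite: Balaban1983RegularityDecay, Theorem p.573, Props. p.574, Lemmas 2.1–2.2 pp.577–578, (2.27) p.580, Cor. 2.3 pp.580–581, Lemma 2.4 p.582] -/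
structure Carriers where
  I₁ : Type
  I₂ : Type
  I₃ : Type
  I₄ : Type
  I₅ : Type
  I₆ : Type
  I₇ : Type
  famE : I₁ → B4.EtaSetting
  famU : I₂ → B4.UnitSetting
  famF : I₃ → B4.FormSetting
  famC₁ : I₄ → B4.CubeSetting
  famC₂ : I₅ → B4.CubeSetting
  famB : I₆ → B4.BlockForm
  famS : I₇ → B4.ScaleSetting
  d : ℕ
  N : ℕ

/-- **BLOCK 41 BUNDLE — the printed statements of [Balaban1983RegularityDecay] pp. 573–582 AS HYPOTHESES, BY NAME**, in
page order; one field per statement, each a reference to the declaration of record typing it (nothing restated; the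
verbatim quotations are in those declarations' docstrings): `c18` — (1.8) p. 573 «there exists a positive constant γ₀
such that for e sufficiently small and for a regular vector field A, −Δ^{η,N}_{A,Ω} + aP_k(A) ≥ γ₀I … γ₀ is independent of
… η, … Ω and … A» (`B4.Claim18Printed`); `thm` — THEOREM (Proposition 2.1 of [1]) p. 573, (1.9)–(1.12) with its last
sentence, in the reading of record: Hölder range `0 ≤ α < 1` (RULING G-ref1-32, `B4RuledReadings`) and the printed
dependency clause «δ₀, c₀, R₀ … depending on d, M only, c₀ on α also» as quantifier order
(`B4ThmAlphaUniform.ThmPrintedNNUnif`; the typed verbatim leaf is `B4.ThmPrinted`, the ruled leaf `B4.ThmPrintedNN` follows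
by `Hyp.thmNN`); `p23` — PROPOSITION 2.3 of [1] p. 574, (1.15)–(1.20) (`B4.Prop23Printed`); `p31` — PROPOSITION 3.1′ of
[2] p. 574, (1.21)–(1.22) (`B4.Prop31Printed`); `l21` — LEMMA 2.1 p. 577, (2.15) (`B4.Lemma21Printed`); `l22` — LEMMA 2.2
pp. 577–578, (2.16)–(2.17) with «p₁ > d» (`B4.Lemma22Printed`); `d227` — (2.27) p. 580 «⟨φ, (−Δ^{η,N}_Δ + a_kP_k)φ⟩ ≥
min{π², a_k}‖φ‖²» (`B4.Display227Printed`, as printed; = `Display227Repaired` whenever `a_k ≤ 8`, `B4.display227_moot`);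
`c23` — COROLLARY 2.3 pp. 580–581, (2.30) with the `δG_k` clause (`B4.Cor23Printed`); `l24` — LEMMA 2.4 p. 582,
(2.35)–(2.37), in the reading of record `0 ≤ α < 1` (`B4.Lemma24PrintedNN` := `B4Lemma24ZeroBoxScale.Lemma24PrintedNN`;
typed verbatim leaf `B4.Lemma24Printed`, `B4.Lemma24Printed.nn`).  Hypothesis slot only. [cite: Balaban1983RegularityDecay, (1.8) p.573, Theorem p.573, Prop. 2.3 of [1] p.574, Prop. 3.1′ of [2] p.574, Lemma 2.1 p.577, Lemma 2.2 pp.577–578, (2.27) p.580, Cor. 2.3 pp.580–581, Lemma 2.4 p.582] -/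
structure Hyp (X : Carriers) : Prop where
  c18 : B4.Claim18Printed X.famE
  thm : B4ThmAlphaUniform.ThmPrintedNNUnif X.famE
  p23 : B4.Prop23Printed X.famU
  p31 : B4.Prop31Printed X.famF
  l21 : B4.Lemma21Printed X.famC₁
  l22 : B4.Lemma22Printed X.famC₂ X.d
  d227 : B4.Display227Printed X.famB
  c23 : B4.Cor23Printed X.famE
  l24 : B4Lemma24ZeroBoxScale.Lemma24PrintedNN X.famS

variable {X : Carriers}

/-- **The Theorem in the ruled leaf form** `B4.ThmPrintedNN` (= `B4Ineq111ZeroNestEta.ThmPrintedNN`: `∀ α ∈ [0,1), ∃ δ₀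
c₀ R₀ e₁, …`) from the bundle's `α`-uniform reading, by the tree's `B4ThmAlphaUniform.thmPrintedNN_of_unif` (instantiate
the `α`-free `δ₀, R₀`).  Bookkeeping. [cite: Balaban1983RegularityDecay, Theorem (1.9)–(1.12) p.573] -/
theorem Hyp.thmNN (h : Hyp X) : B4Ineq111ZeroNestEta.ThmPrintedNN X.famE :=
  B4ThmAlphaUniform.thmPrintedNN_of_unif X.famE h.thm

/-- **The DAG's `b4` leaf in its N-binding** (`DagBinding.Upstream.ofPrintedAllXPN`, whose `b4` field is
`DagDischargedII.B4LeafNN famE famU famF d N := ThmPrintedNN famE ∧ Prop23Printed famU ∧ Prop31Printed famF ∧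
Sect5ThmUniform d N` — this conjunction, definitionally): the bundle (Theorem, Prop. 2.3, Prop. 3.1′ — this block) together
with the SECT. 5 THEOREM p. 594 in its uniform reading (block 42's statement, `B4.Sect5ThmUniform`) gives it.  Bookkeeping.
[cite: Balaban1983RegularityDecay, Theorem p.573, Props. p.574, Sect. 5 Theorem p.594] -/
theorem Hyp.b4LeafNN (h : Hyp X) (h5 : B4.Sect5ThmUniform X.d X.N) :
    B4Ineq111ZeroNestEta.ThmPrintedNN X.famE ∧ B4.Prop23Printed X.famU ∧ B4.Prop31Printed X.famF ∧
      B4.Sect5ThmUniform X.d X.N :=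
  ⟨h.thmNN, h.p23, h.p31, h5⟩

/-- **The typed DAG leaf `B4.LeafB4`** (= the `b4` field of `DagBinding.Upstream.ofPrinted`, whose first conjunct is the
LITERAL typed Theorem `B4.ThmPrinted`, «α < 1» incl. `α < 0`): from the bundle's Prop. 2.3 and Prop. 3.1′ together with
the literal Theorem and the Sect. 5 Theorem as EXTRA hypotheses (`B4.leafB4_intro`).  The literal leaf is not derivable
from the ruled reading `Hyp.thm` (it is refuted on the zero-field carriers, `B4Thm19ZeroBoxNegAlpha.not_thmPrinted_boxFam`;
RULING G-ref1-32) — hence the explicit hypothesis.  Bookkeeping. [cite: Balaban1983RegularityDecay, Theorem p.573, Props. p.574, Sect. 5 Theorem p.594] -/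
theorem Hyp.leafB4_of_literal (h : Hyp X) (hT : B4.ThmPrinted X.famE) (h5 : B4.Sect5ThmUniform X.d X.N) :
    B4.LeafB4 X.famE X.famU X.famF X.d X.N :=
  B4.leafB4_intro hT h.p23 h.p31 h5

/-- The carriers of this block read off the DAG's record `DagBinding.PrintedCarriers` (its B4 group of fields `famE`,
`famU`, `famF`, `d4`, `N4`), extended by the four Sect. 2 families. [cite: Balaban1983RegularityDecay, Theorem p.573, Props. p.574, Lemmas 2.1–2.4 pp.577–582] -/
def Carriers.ofDag (Xc : DagBinding.PrintedCarriers) {I₄ I₅ I₆ I₇ : Type} (famC₁ : I₄ → B4.CubeSetting)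
    (famC₂ : I₅ → B4.CubeSetting) (famB : I₆ → B4.BlockForm) (famS : I₇ → B4.ScaleSetting) : Carriers where
  I₁ := Xc.I4E
  I₂ := Xc.I4U
  I₃ := Xc.I4F
  I₄ := I₄
  I₅ := I₅
  I₆ := I₆
  I₇ := I₇
  famE := Xc.famE
  famU := Xc.famU
  famF := Xc.famF
  famC₁ := famC₁
  famC₂ := famC₂
  famB := famB
  famS := famS
  d := Xc.d4
  N := Xc.N4

/-- **The DAG's typed `b4` leaf**: at the carriers of `DagBinding.PrintedCarriers`, the bundle together with the literal
typed Theorem and the Sect. 5 Theorem (block 42) IS the upstream leaf `b4 = B4.LeafB4 X.famE X.famU X.famF X.d4 X.N4` of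
`DagBinding.Upstream.ofPrinted` (node [B4] of the K⁷ consumer).  Bookkeeping. [cite: Balaban1983RegularityDecay, Theorem p.573, Props. p.574, Sect. 5 Theorem p.594] -/
theorem Hyp.dag_b4 {Xc : DagBinding.PrintedCarriers} {I₄ I₅ I₆ I₇ : Type} {famC₁ : I₄ → B4.CubeSetting}
    {famC₂ : I₅ → B4.CubeSetting} {famB : I₆ → B4.BlockForm} {famS : I₇ → B4.ScaleSetting}
    (h : Hyp (Carriers.ofDag Xc famC₁ famC₂ famB famS)) (hT : B4.ThmPrinted Xc.famE)
    (h5 : B4.Sect5ThmUniform Xc.d4 Xc.N4) (b9 b11 rOp rBS : Prop) :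
    (DagBinding.Upstream.ofPrinted Xc b9 b11 rOp rBS).b4 :=
  (show B4.LeafB4 Xc.famE Xc.famU Xc.famF Xc.d4 Xc.N4 from h.leafB4_of_literal hT h5)

/-- Lemma 2.4's `α`-free conjunct — (2.35) (both kernels) and (2.37) with one pair `c₀, δ₀` — from the bundle's ruled leaf
(common to the typed and the ruled reading; cf. `B4.Lemma24Printed.bounds235_237`).  Bookkeeping.
[cite: Balaban1983RegularityDecay, Lemma 2.4 (2.35), (2.37) p.582] -/
theorem Hyp.bounds235_237 (h : Hyp X) :
    ∃ c₀ δ₀ : ℝ, 0 < c₀ ∧ 0 < δ₀ ∧ ∀ i : X.I₇, (X.famS i).rectLarge →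
      (∀ (x : (X.famS i).SiteF) (y : (X.famS i).SiteU),
          (X.famS i).kerGQ x y ≤ c₀ * Real.exp (-(δ₀ * (X.famS i).distF x y))) ∧
      (∀ (μ : (X.famS i).Dir) (x : (X.famS i).SiteF) (y : (X.famS i).SiteU),
          (X.famS i).kerDGQ μ x y ≤ c₀ * Real.exp (-(δ₀ * (X.famS i).distF x y))) ∧
      (∀ y y' : (X.famS i).SiteU, (X.famS i).kerC y y' ≤ c₀ * Real.exp (-(δ₀ * (X.famS i).distU y y'))) := by
  obtain ⟨c₀, δ₀, hc, hδ, h1, -⟩ := h.l24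
  exact ⟨c₀, δ₀, hc, hδ, h1⟩

end Literature.MathematicalPhysics.QuantumFieldTheory.Balaban1983to89.B4Carve41Sects12Hyp
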